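import Summits.AtomisticToContinuum.Crystallization.Theorems.FrustratedLawDichotomyGSCVanHoveBalls
import Summits.AtomisticToContinuum.Crystallization.Theorems.FrustratedLawDichotomyGSCOneAtomTests
import Summits.AtomisticToContinuum.Crystallization.Theorems.ChargedEnergyGap.Negative.NoBoundaryReduction

/-!
# FrustratedLawDichotomy · crux `AperiodicFrustratedLawGap` (stmt-AtomisticToContinuum-27623) — THE LOCAL-CLOSE-ORDER STATEMENT FOLLOWS FROM
# THE WEAKEST FINITE PRICE: A FRUSTRATION *DENSITY* GAP WITH CLOSE-PACKED SITES REFUNDED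
# (decomp-a2c, prover hand 2, structural share, generation 7; route-independent module)

`LCO` (`FrustratedLawDichotomyLocalCloseOrder`: every rooted `7/10`-separated `e⋆`-μGSC of `V_LJ` has a ROBUSTLY GOOD atom) closes the
law-free residual of the crux.  This file SPECIALISES it to finite clusters: `LCO` follows from the finite, census-testable statement

* `FDG` («frustration density gap»): there are `κ > 0` and `C` such that every finite injective `7/10`-separated configuration
  `y : Fin N → ℝ³` satisfies `κ·N − C·#{i : y i is a robustly good site of the SET range y} ≤ U(y) − N·e⋆`.

`FDG` prices only the ENERGY DENSITY of frustration and refunds every close-packed site at rate `C`; it is implied by every per-site price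
(hand-1's positive local excess, `PricedLinkCensus.ChargedEnergyGap` granted a kissing-rigidity lemma, the transport residual R5 of
generation 3), and it is the weakest quantitative crystallization statement in this currency that still closes the crux: an all-bad cluster
must have energy per atom `≥ e⋆ + κ`, however large.  Numerically (census orientation, not used): amorphous / icosahedral / Frank–Kasper
Lennard-Jones packings sit `5–8 %` of `|e⋆|` above `e⋆`.

Proof of `localCloseOrder_of_frustrationDensityGap` (`FDG → LCO`): let `X` be a rooted `7/10`-separated `e⋆`-μGSC with no robustly good
atom.  (i) NO RATTLERS (`exists_near_of_isMuGSC`): every atom has another within distance `50` (binding test `h_p ≤ e⋆ ≤ −1/24` against the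
far-field bound `T(7/10, 50) < 1/24`).  (ii) THIN-SHELL BALLS (`exists_thinShell_ball`, the Følner radii of item 27625 via
`FrustratedLawDichotomyFolnerRadius.stub_folnerRadius`): root-centred ball clusters `C = X ∩ B̄(0,r)` whose outer shell of thickness `L → ∞`
carries a fraction `ε → 0` of the atoms, hence (`abs_cross_le_of_ball`) `|I(C, X∖C)| ≤ n·T(L) + #shell·T(7/10)`.  (iii) DEEP SITES
(`robustGood_of_deep`): a robustly good site of the finite set `C` deeper than `66 = 13/10·50 + 1` inside the ball is robustly good in `X`
(gap capped at `1`) — so under the standing assumption every good site of `C` lies in the shell.  (iv) CLUSTER EXACTNESS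
(`excess_le_neg_cross`): `U(C) − n·e⋆ ≤ −I(C, X∖C)`.  Chaining, `κ·n − C·#shell ≤ n·T(L) + #shell·T(7/10)`, i.e. `κ ≤ T(L) + ε·(T(7/10) + C)`,
absurd for `L` large and `ε` small.  `[folklore]` bookkeeping on landed lemmas.
-/

noncomputable section

namespace Summit.AtomisticToContinuum.Crystallization.Theorems.FrustratedLawDichotomyLocalCloseOrderFinite

open Filter Topology Metric
open Literature.MathematicalPhysics.StatisticalMechanics
open Literature.Geometry.DiscreteGeometry
open Summit.AtomisticToContinuum.Crystallization.Theorems.ChargedEnergyGapNegative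
  (E3 eStar card_mul_eStar_le dimer dimer_injective interactionEnergy_dimer)
open Summit.AtomisticToContinuum.Crystallization.Theorems.FrustratedLawDichotomyGSCClusterExactness (excess_le_neg_cross)
open Summit.AtomisticToContinuum.Crystallization.Theorems.FrustratedLawDichotomyGSCVanHoveBalls
  (abs_tsum_field_le_of_far abs_cross_le_of_ball tail_antitone)
open Summit.AtomisticToContinuum.Crystallization.Theorems.FrustratedLawDichotomyGSCOneAtomTests (binding_le_of_isMuGSC)
open Summit.AtomisticToContinuum.Crystallization.Theorems.FrustratedLawDichotomyFolnerRadius (stub_folnerRadius)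

variable {X : Set E3}

/-! ## §1. No rattlers in an exact μ-equilibrium (configuration level) -/

/-- **NO RATTLERS**: in a `7/10`-separated `e⋆`-μGSC of `V_LJ` every atom has another atom within distance `50`: otherwise its binding
`Σ' V ≤ e⋆ ≤ −1/24` (`binding_le_of_isMuGSC`) contradicts the far-field bound `|Σ' V| ≤ T(7/10, 50) < 1/24`. [folklore] -/
theorem exists_near_of_isMuGSC (hsep : ∀ a ∈ X, ∀ b ∈ X, a ≠ b → (7 : ℝ) / 10 ≤ dist a b)
    (h : IsMuGSC lennardJones eStar X) {p : E3} (hp : p ∈ X) : ∃ q ∈ X, q ≠ p ∧ dist q p < 50 := by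
  by_contra hfar
  push Not at hfar
  have hbind := binding_le_of_isMuGSC h hp
  have hsep' : ∀ a ∈ X \ {p}, ∀ b ∈ X \ {p}, a ≠ b → (7 : ℝ) / 10 ≤ dist a b :=
    fun a ha b hb hab => hsep a ha.1 b hb.1 hab
  have hT := abs_tsum_field_le_of_far (Y := X \ {p}) (by norm_num : (0 : ℝ) < 7 / 10) hsep' p (Rc := 50) (by norm_num)
    (fun y hy => by rw [dist_comm]; exact hfar y hy.1 fun h => hy.2 h)
  have hnum : ((7 / 10 : ℝ)⁻¹ ^ 6 / 12 + 1 / 6) * (1024 / ((7 / 10 : ℝ) ^ 3 * (50 : ℝ) ^ 3)) < 1 / 24 := by norm_num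
  -- `e⋆ ≤ −1/24` (periodise the unit dimer; = `PricedLinkCensusLocalToGlobalPhaseGap.eStar_le_neg`, inlined to stay in this import cone)
  have h24 : eStar ≤ -1 / 24 := by
    have h := card_mul_eStar_le dimer_injective
    rw [interactionEnergy_dimer] at h
    push_cast at h
    linarith
  have := neg_abs_le (∑' y : ↥(X \ {p}), lennardJones (dist p y))
  linarith

/-! ## §2. Thin-shell balls around the root -/

/-- **THIN-SHELL BALL** at scale `R ≥ 0` (the Følner-radius property `hF` of item 27625, as consumed by
`FrustratedLawDichotomyGSCVanHoveBalls.exists_ball_cluster`, here with the shell count itself in the conclusion): a root-centred ball cluster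
`C = xf(Fin n) = X ∩ B̄(0, r)`, `r ≥ R/4`, whose outer shell of thickness `Ls R` holds at most `εs R · n` atoms. [folklore] -/
theorem exists_thinShell_ball {δ : ℝ} (hδ : 0 < δ) (hsep : ∀ a ∈ X, ∀ b ∈ X, a ≠ b → δ ≤ dist a b) (h0 : (0 : E3) ∈ X)
    {Ls εs : ℝ → ℝ}
    (hF : ∀ (R : ℝ) (N : ℕ) (y : Fin N → EuclideanSpace ℝ (Fin 3)) (i : Fin N), 0 ≤ R →
      (∀ a b : Fin N, a ≠ b → δ ≤ dist (y a) (y b)) →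
      ∃ r : ℝ, R / 4 ≤ r ∧ r ≤ R / 2 ∧
        (((Finset.univ.filter (fun j : Fin N => r - Ls R < dist (y j) (y i) ∧ dist (y j) (y i) ≤ r))).card : ℝ) ≤
          εs R * (((Finset.univ.filter (fun j : Fin N => dist (y j) (y i) ≤ r))).card : ℝ))
    {R : ℝ} (hR : 0 ≤ R) :
    ∃ (r : ℝ) (n : ℕ) (xf : Fin n → E3), R / 4 ≤ r ∧ Function.Injective xf ∧ Set.range xf = X ∩ closedBall 0 r ∧ 0 < n ∧
      ((Finset.univ.filter fun m : Fin n => r - Ls R < ‖xf m‖).card : ℝ) ≤ εs R * (n : ℝ) := by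
  classical
  have hfin : (X ∩ closedBall (0 : E3) R).Finite :=
    finite_of_forall_le_dist_of_subset_closedBall hδ (fun p hp q hq hpq => hsep p hp.1 q hq.1 hpq) Set.inter_subset_right
  obtain ⟨N, y, hy⟩ := hfin.fin_embedding
  have hyX : ∀ j, y j ∈ X ∩ closedBall (0 : E3) R := fun j => hy ▸ Set.mem_range_self j
  have h0mem : (0 : E3) ∈ Set.range y := by rw [hy]; exact ⟨h0, mem_closedBall_self hR⟩
  obtain ⟨i₀, hi₀⟩ := h0mem
  have hysep : ∀ a b : Fin N, a ≠ b → δ ≤ dist (y a) (y b) := fun a b hab =>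
    hsep (y a) (hyX a).1 (y b) (hyX b).1 fun h => hab (y.injective h)
  obtain ⟨r, hr1, hr2, hshell⟩ := hF R N y i₀ hR hysep
  have hyi₀ : ∀ j, dist (y j) (y i₀) = ‖y j‖ := fun j => by rw [hi₀, dist_zero_right]
  simp only [hyi₀] at hshell
  set s : Finset (Fin N) := Finset.univ.filter fun j : Fin N => ‖y j‖ ≤ r with hs
  have hmem_s : ∀ j : Fin N, j ∈ s ↔ ‖y j‖ ≤ r := fun j => by simp [hs]
  set e := s.equivFin with he
  set xf : Fin s.card → E3 := fun m => y ((e.symm m : ↥s) : Fin N) with hxf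
  have hxf_inj : Function.Injective xf := fun a b hab =>
    e.symm.injective (Subtype.ext (y.injective hab))
  have hrange : Set.range xf = X ∩ closedBall 0 r := by
    ext p
    constructor
    · rintro ⟨m, rfl⟩
      refine ⟨(hyX _).1, ?_⟩
      rw [mem_closedBall, dist_zero_right]
      exact (hmem_s _).1 (e.symm m).2
    · rintro ⟨hpX, hpr⟩
      rw [mem_closedBall, dist_zero_right] at hpr
      have hpR : p ∈ X ∩ closedBall (0 : E3) R :=
        ⟨hpX, by rw [mem_closedBall, dist_zero_right]; linarith⟩
      rw [← hy] at hpR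
      obtain ⟨j, rfl⟩ := hpR
      refine ⟨e ⟨j, (hmem_s j).2 hpr⟩, ?_⟩
      simp only [hxf, Equiv.symm_apply_apply]
  have hnpos : 0 < s.card := by
    rw [Finset.card_pos]
    exact ⟨i₀, (hmem_s i₀).2 (by rw [hi₀, norm_zero]; linarith)⟩
  refine ⟨r, s.card, xf, hr1, hxf_inj, hrange, hnpos, ?_⟩
  have hcard : ((Finset.univ.filter fun m : Fin s.card => r - Ls R < ‖xf m‖).card : ℝ) ≤
      ((Finset.univ.filter fun j : Fin N => r - Ls R < ‖y j‖ ∧ ‖y j‖ ≤ r).card : ℝ) := by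
    have h := Finset.card_le_card_of_injOn (s := Finset.univ.filter fun m : Fin s.card => r - Ls R < ‖xf m‖)
      (t := Finset.univ.filter fun j : Fin N => r - Ls R < ‖y j‖ ∧ ‖y j‖ ≤ r)
      (fun m : Fin s.card => ((e.symm m : ↥s) : Fin N))
      (fun m hm => by
        simp only [Finset.coe_filter, Finset.mem_univ, true_and, Set.mem_setOf_eq] at hm ⊢
        exact ⟨hm, (hmem_s _).1 (e.symm m).2⟩)
      (fun a _ b _ hab => e.symm.injective (Subtype.ext hab))
    exact_mod_cast h
  have hball : ((Finset.univ.filter fun j : Fin N => ‖y j‖ ≤ r).card : ℝ) = (s.card : ℝ) := by rw [hs]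
  rw [← hball]; exact hcard.trans hshell

/-! ## §3. Deep good sites of a ball cluster are good sites of the configuration -/

/-- **DEEP TRANSFER**: let `C ⊆ X` contain every atom of `X` of norm `≤ r`, and let `p` be a robustly good atom of the SET `C` (pattern `Pat`,
data `(d, η, γ, A, t)`) with `‖p‖ + 13/10·d + min γ 1 ≤ r`.  Then `p` is robustly good in `X` with data `(d, η, min γ 1, A, t)`: the atoms of
`X` outside `C` are farther than `13/10·d + min γ 1` from `p`. [folklore] -/
theorem robustGood_of_deep {C : Set E3} (hCX : C ⊆ X) {r : ℝ} (hXC : ∀ s ∈ X, ‖s‖ ≤ r → s ∈ C)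
    {Pat : Finset E3} {p : E3} {d η γ : ℝ} {A : E3 →ₗᵢ[ℝ] E3} {t : ↥Pat → E3}
    (h : 0 < d ∧ 0 < γ ∧ η < 1 / 20 ∧ (∀ u : ↥Pat, t u ∈ C ∧ ‖(t u - p) - d • A (u : EuclideanSpace ℝ (Fin 3))‖ ≤ η * d) ∧ (∀ s : EuclideanSpace ℝ (Fin 3), s ∈ C → s ≠ p → d ≤ dist s p) ∧ (∃ s : EuclideanSpace ℝ (Fin 3), s ∈ C ∧ s ≠ p ∧ dist s p ≤ d) ∧ (∀ s : EuclideanSpace ℝ (Fin 3), s ∈ C → s ≠ p → dist s p < 13 / 10 * d + γ → dist s p ≤ 13 / 10 * d - γ ∧ s ∈ Set.range t))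
    (hdeep : ‖p‖ + 13 / 10 * d + min γ 1 ≤ r) :
    0 < d ∧ 0 < (min γ 1) ∧ η < 1 / 20 ∧ (∀ u : ↥Pat, t u ∈ X ∧ ‖(t u - p) - d • A (u : EuclideanSpace ℝ (Fin 3))‖ ≤ η * d) ∧ (∀ s : EuclideanSpace ℝ (Fin 3), s ∈ X → s ≠ p → d ≤ dist s p) ∧ (∃ s : EuclideanSpace ℝ (Fin 3), s ∈ X ∧ s ≠ p ∧ dist s p ≤ d) ∧ (∀ s : EuclideanSpace ℝ (Fin 3), s ∈ X → s ≠ p → dist s p < 13 / 10 * d + (min γ 1) → dist s p ≤ 13 / 10 * d - (min γ 1) ∧ s ∈ Set.range t) := by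
  obtain ⟨hd, hγ, hη, ht, hnn₁, hnn₂, hgap⟩ := h
  have hγ' : 0 < min γ 1 := lt_min hγ one_pos
  have hγ'le : min γ 1 ≤ γ := min_le_left _ _
  -- atoms of `X` outside `C` are far from `p`
  have hout : ∀ s ∈ X, s ∉ C → 13 / 10 * d + min γ 1 < dist s p := by
    intro s hs hsC
    have hsr : r < ‖s‖ := by
      by_contra hle
      exact hsC (hXC s hs (not_lt.1 hle))
    have h1 : ‖s‖ ≤ ‖p‖ + dist s p := by
      rw [dist_eq_norm]
      have := norm_add_le p (s - p)
      rwa [add_sub_cancel] at this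
    linarith
  refine ⟨hd, hγ', hη, fun u => ⟨hCX (ht u).1, (ht u).2⟩, fun s hs hsp => ?_, ?_, fun s hs hsp hlt => ?_⟩
  · by_cases hsC : s ∈ C
    · exact hnn₁ s hsC hsp
    · have := hout s hs hsC
      nlinarith [hγ'.le]
  · obtain ⟨s, hs, hsp, hsd⟩ := hnn₂
    exact ⟨s, hCX hs, hsp, hsd⟩
  · by_cases hsC : s ∈ C
    · have hlt' : dist s p < 13 / 10 * d + γ := by linarith
      obtain ⟨h1, h2⟩ := hgap s hsC hsp hlt'
      exact ⟨by linarith, h2⟩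
    · exact absurd hlt (not_lt.2 (hout s hs hsC).le)

/-! ## §4. `FDG → LCO` -/

/-- **THE LOCAL-CLOSE-ORDER STATEMENT FROM THE FRUSTRATION DENSITY GAP** (module docstring, steps (i)–(iv)).  `FDG`: some `κ > 0` and `C`
price every finite injective `7/10`-separated `y` by `κ·N − C·#{robustly good sites of range y} ≤ U(y) − N·e⋆`.  Conclusion `LCO` (text of
`FrustratedLawDichotomyLocalCloseOrder`): every rooted `7/10`-separated `e⋆`-μGSC of `V_LJ` has a robustly good atom. [folklore] -/
theorem localCloseOrder_of_frustrationDensityGap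
    (hFDG : ∃ κ : ℝ, 0 < κ ∧ ∃ C : ℝ, ∀ (N : ℕ) (y : Fin N → EuclideanSpace ℝ (Fin 3)), Function.Injective y → (∀ a b : Fin N, a ≠ b → (7 : ℝ) / 10 ≤ dist (y a) (y b)) → κ * N - C * (Nat.card {i : Fin N // ∃ (d η γ : ℝ) (A : EuclideanSpace ℝ (Fin 3) →ₗᵢ[ℝ] EuclideanSpace ℝ (Fin 3)), (∃ t : ↥Literature.Geometry.DiscreteGeometry.fccKissingPattern → EuclideanSpace ℝ (Fin 3), 0 < d ∧ 0 < γ ∧ η < 1 / 20 ∧ (∀ u : ↥Literature.Geometry.DiscreteGeometry.fccKissingPattern, t u ∈ (Set.range y) ∧ ‖(t u - (y i)) - d • A (u : EuclideanSpace ℝ (Fin 3))‖ ≤ η * d) ∧ (∀ s : EuclideanSpace ℝ (Fin 3), s ∈ (Set.range y) → s ≠ (y i) → d ≤ dist s (y i)) ∧ (∃ s : EuclideanSpace ℝ (Fin 3), s ∈ (Set.range y) ∧ s ≠ (y i) ∧ dist s (y i) ≤ d) ∧ (∀ s : EuclideanSpace ℝ (Fin 3), s ∈ (Set.range y) → s ≠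 (y i) → dist s (y i) < 13 / 10 * d + γ → dist s (y i) ≤ 13 / 10 * d - γ ∧ s ∈ Set.range t)) ∨ (∃ t : ↥Literature.Geometry.DiscreteGeometry.hcpKissingPattern → EuclideanSpace ℝ (Fin 3), 0 < d ∧ 0 < γ ∧ η < 1 / 20 ∧ (∀ u : ↥Literature.Geometry.DiscreteGeometry.hcpKissingPattern, t u ∈ (Set.range y) ∧ ‖(t u - (y i)) - d • A (u : EuclideanSpace ℝ (Fin 3))‖ ≤ η * d) ∧ (∀ s : EuclideanSpace ℝ (Fin 3), s ∈ (Set.range y) → s ≠ (y i) → d ≤ dist s (y i)) ∧ (∃ s : EuclideanSpace ℝ (Fin 3), s ∈ (Set.range y) ∧ s ≠ (y i) ∧ dist s (y i) ≤ d) ∧ (∀ s : EuclideanSpace ℝ (Fin 3), s ∈ (Set.range y) → s ≠ (y i) → dist s (y i) < 13 / 10 * d + γ → dist s (y i) ≤ 13 / 10 * d - γ ∧ s ∈ Set.range t))} : ℝ) ≤ Literature.MathematicalPhysics.StatisticalMechanics.interactionEnergy Literature.MathematicalPhysics.StatisticalMechanics.lennardJones y - N * (⨅ Q : Literature.MathematicalPhysics.StatisticalMechanics.PeriodicConfiguration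 3, Q.energyPerParticle Literature.MathematicalPhysics.StatisticalMechanics.lennardJones)) :
    ∀ X : Set (EuclideanSpace ℝ (Fin 3)), (0 : EuclideanSpace ℝ (Fin 3)) ∈ X → (∀ a ∈ X, ∀ b ∈ X, a ≠ b → (7 : ℝ) / 10 ≤ dist a b) → Literature.MathematicalPhysics.StatisticalMechanics.IsMuGSC Literature.MathematicalPhysics.StatisticalMechanics.lennardJones (⨅ Q : Literature.MathematicalPhysics.StatisticalMechanics.PeriodicConfiguration 3, Q.energyPerParticle Literature.MathematicalPhysics.StatisticalMechanics.lennardJones) X → ∃ p : EuclideanSpace ℝ (Fin 3), p ∈ X ∧ ∃ (d η γ : ℝ) (A : EuclideanSpace ℝ (Fin 3) →ₗᵢ[ℝ] EuclideanSpace ℝ (Fin 3)), (∃ t : ↥Literature.Geometry.DiscreteGeometry.fccKissingPattern → EuclideanSpace ℝ (Fin 3), 0 < d ∧ 0 < γ ∧ η < 1 / 20 ∧ (∀ u : ↥Literature.Geometry.DiscreteGeometry.fccKissingPattern, t u ∈ X ∧ ‖(t u - p) - d • A (u : EuclideanSpace ℝ (Fin 3))‖ ≤ η * d) ∧ (∀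 s : EuclideanSpace ℝ (Fin 3), s ∈ X → s ≠ p → d ≤ dist s p) ∧ (∃ s : EuclideanSpace ℝ (Fin 3), s ∈ X ∧ s ≠ p ∧ dist s p ≤ d) ∧ (∀ s : EuclideanSpace ℝ (Fin 3), s ∈ X → s ≠ p → dist s p < 13 / 10 * d + γ → dist s p ≤ 13 / 10 * d - γ ∧ s ∈ Set.range t)) ∨ (∃ t : ↥Literature.Geometry.DiscreteGeometry.hcpKissingPattern → EuclideanSpace ℝ (Fin 3), 0 < d ∧ 0 < γ ∧ η < 1 / 20 ∧ (∀ u : ↥Literature.Geometry.DiscreteGeometry.hcpKissingPattern, t u ∈ X ∧ ‖(t u - p) - d • A (u : EuclideanSpace ℝ (Fin 3))‖ ≤ η * d) ∧ (∀ s : EuclideanSpace ℝ (Fin 3), s ∈ X → s ≠ p → d ≤ dist s p) ∧ (∃ s : EuclideanSpace ℝ (Fin 3), s ∈ X ∧ s ≠ p ∧ dist s p ≤ d) ∧ (∀ s : EuclideanSpace ℝ (Fin 3), s ∈ X → s ≠ p → dist s p < 13 / 10 * d + γ → dist s p ≤ 13 / 10 * d - γ ∧ s ∈ Set.range t)) :=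 by
  classical
  obtain ⟨κ, hκ, C, hF⟩ := hFDG
  intro X h0 hsep hGSC
  by_contra hno
  -- the Følner radii (item 27625, landed)
  obtain ⟨Ls, εs, hLs, hεs, hFol⟩ := stub_folnerRadius (7 / 10) (by norm_num)
  -- constants, introduced by equations
  obtain ⟨K, hK⟩ : ∃ K : ℝ, K = (7 / 10 : ℝ)⁻¹ ^ 6 / 12 + 1 / 6 := ⟨_, rfl⟩
  have hKpos : 0 < K := by rw [hK]; positivity
  obtain ⟨T₀, hT₀def⟩ : ∃ T₀ : ℝ, T₀ = K * (1024 / ((7 / 10 : ℝ) ^ 3 * (7 / 10 : ℝ) ^ 3)) := ⟨_, rfl⟩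
  have hT₀ : 0 ≤ T₀ := by rw [hT₀def]; positivity
  obtain ⟨C', hC'def⟩ : ∃ C' : ℝ, C' = max C 0 := ⟨_, rfl⟩
  have hC'0 : 0 ≤ C' := by rw [hC'def]; exact le_max_right _ _
  have hCC' : C ≤ C' := by rw [hC'def]; exact le_max_left _ _
  obtain ⟨M₀, hM₀def⟩ : ∃ M₀ : ℝ, M₀ = max 66 (4 * K * 1024 / ((7 / 10 : ℝ) ^ 3 * κ)) := ⟨_, rfl⟩
  have hM₀66 : (66 : ℝ) ≤ M₀ := by rw [hM₀def]; exact le_max_left _ _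
  have hM₀κ : 4 * K * 1024 / ((7 / 10 : ℝ) ^ 3 * κ) ≤ M₀ := by rw [hM₀def]; exact le_max_right _ _
  have hM₀pos : 0 < M₀ := by linarith
  -- choose the scale `R`: thick shell `Ls R ≥ M₀`, small shell fraction `εs R`
  have e1 : ∀ᶠ R in atTop, M₀ ≤ Ls R := hLs.eventually_ge_atTop M₀
  have hcpos : 0 < κ / (4 * (T₀ + C' + 1)) := by positivity
  have e2 : ∀ᶠ R in atTop, εs R < κ / (4 * (T₀ + C' + 1)) := (tendsto_order.1 hεs).2 _ hcpos
  have e3 : ∀ᶠ R : ℝ in atTop, 0 ≤ R := eventually_ge_atTop 0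
  obtain ⟨R, hR₁, hR₂, hR₃⟩ := (e1.and (e2.and e3)).exists
  -- the thin-shell ball at scale `R`
  obtain ⟨r, n, xf, -, hinj, hrange, hnpos, hshell⟩ :=
    exists_thinShell_ball (by norm_num : (0 : ℝ) < 7 / 10) hsep h0 hFol hR₃
  have hsub : Set.range xf ⊆ X := hrange.le.trans Set.inter_subset_left
  have hXC : ∀ s ∈ X, ‖s‖ ≤ r → s ∈ Set.range xf := fun s hs hsr => by
    rw [hrange]; exact ⟨hs, mem_closedBall_zero_iff.2 hsr⟩
  have hnr : (0 : ℝ) < n := by exact_mod_cast hnpos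
  -- (iv) cluster exactness and (ii) the cross bound
  have hex := excess_le_neg_cross hGSC hinj hsub
  have hI := abs_cross_le_of_ball (by norm_num : (0 : ℝ) < 7 / 10) hsep (r := r) (L := Ls R) hrange
  rw [← hK] at hI
  rw [← hT₀def] at hI
  have hnegI := neg_le_abs (∑ i, ∑' y : ↥(X \ Set.range xf), lennardJones (dist (xf i) y))
  -- the tail at thickness `Ls R` is at most `κ/4`
  have hLsR : M₀ ≤ max (Ls R) (7 / 10) := hR₁.trans (le_max_left _ _)
  have hT₁ : K * (1024 / ((7 / 10 : ℝ) ^ 3 * (max (Ls R) (7 / 10)) ^ 3)) ≤ κ / 4 := by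
    have h1 := tail_antitone (by norm_num : (0 : ℝ) < 7 / 10) hM₀pos hLsR
    rw [← hK] at h1
    have hM1 : (1 : ℝ) ≤ M₀ := by linarith
    have hsq : (1 : ℝ) ≤ M₀ * M₀ := by nlinarith
    have h3 : M₀ ≤ M₀ ^ 3 := by
      calc M₀ = M₀ * 1 := (mul_one _).symm
        _ ≤ M₀ * (M₀ * M₀) := mul_le_mul_of_nonneg_left hsq hM₀pos.le
        _ = M₀ ^ 3 := by ring
    have h4 : K * (1024 / ((7 / 10 : ℝ) ^ 3 * M₀ ^ 3)) ≤ K * (1024 / ((7 / 10 : ℝ) ^ 3 * M₀)) := by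
      refine mul_le_mul_of_nonneg_left ?_ hKpos.le
      exact div_le_div_of_nonneg_left (by norm_num) (by positivity) (mul_le_mul_of_nonneg_left h3 (by positivity))
    have h5 : K * (1024 / ((7 / 10 : ℝ) ^ 3 * M₀)) ≤ κ / 4 := by
      have h2' : 4 * K * 1024 ≤ M₀ * ((7 / 10 : ℝ) ^ 3 * κ) := (div_le_iff₀ (by positivity)).1 hM₀κ
      rw [mul_div_assoc', div_le_iff₀ (by positivity)]
      linarith
    linarith
  -- (iii) every robustly good site of the cluster lies in the shell
  have hgood_shell : ∀ i : Fin n, (∃ (d η γ : ℝ) (A : EuclideanSpace ℝ (Fin 3) →ₗᵢ[ℝ] EuclideanSpace ℝ (Fin 3)), (∃ t : ↥Literature.Geometry.DiscreteGeometry.fccKissingPattern → EuclideanSpace ℝ (Fin 3), 0 < d ∧ 0 < γ ∧ η < 1 / 20 ∧ (∀ u : ↥Literature.Geometry.DiscreteGeometry.fccKissingPattern, t u ∈ (Set.range xf) ∧ ‖(t u - (xf i)) - d • A (u : EuclideanSpace ℝ (Fin 3))‖ ≤ η * d) ∧ (∀ s : EuclideanSpace ℝ (Fin 3), s ∈ (Set.range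 xf) → s ≠ (xf i) → d ≤ dist s (xf i)) ∧ (∃ s : EuclideanSpace ℝ (Fin 3), s ∈ (Set.range xf) ∧ s ≠ (xf i) ∧ dist s (xf i) ≤ d) ∧ (∀ s : EuclideanSpace ℝ (Fin 3), s ∈ (Set.range xf) → s ≠ (xf i) → dist s (xf i) < 13 / 10 * d + γ → dist s (xf i) ≤ 13 / 10 * d - γ ∧ s ∈ Set.range t)) ∨ (∃ t : ↥Literature.Geometry.DiscreteGeometry.hcpKissingPattern → EuclideanSpace ℝ (Fin 3), 0 < d ∧ 0 < γ ∧ η < 1 / 20 ∧ (∀ u : ↥Literature.Geometry.DiscreteGeometry.hcpKissingPattern, t u ∈ (Set.range xf) ∧ ‖(t u - (xf i)) - d • A (u : EuclideanSpace ℝ (Fin 3))‖ ≤ η * d) ∧ (∀ s : EuclideanSpace ℝ (Fin 3), s ∈ (Set.range xf) → s ≠ (xf i) → d ≤ dist s (xf i)) ∧ (∃ s : EuclideanSpace ℝ (Fin 3), s ∈ (Set.range xf) ∧ s ≠ (xf i) ∧ dist s (xf i) ≤ d) ∧ (∀ s : EuclideanSpace ℝ (Fin 3), s ∈ (Set.range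 xf) → s ≠ (xf i) → dist s (xf i) < 13 / 10 * d + γ → dist s (xf i) ≤ 13 / 10 * d - γ ∧ s ∈ Set.range t))) → r - Ls R < ‖xf i‖ := by
    intro i hgood
    by_contra hdeep
    rw [not_lt] at hdeep
    have hLs66 : (66 : ℝ) ≤ Ls R := hM₀66.trans hR₁
    obtain ⟨q, hqX, hqp, hqd⟩ := exists_near_of_isMuGSC hsep hGSC (hsub ⟨i, rfl⟩)
    have hqC : q ∈ Set.range xf := by
      refine hXC q hqX ?_
      have h1 : ‖q‖ ≤ ‖xf i‖ + dist q (xf i) := by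
        rw [dist_eq_norm]
        have := norm_add_le (xf i) (q - xf i)
        rwa [add_sub_cancel] at this
      linarith
    apply hno
    obtain ⟨d, η, γ, A, hgood⟩ := hgood
    rcases hgood with ⟨t, hg⟩ | ⟨t, hg⟩
    · have hd50 : d ≤ 50 := (hg.2.2.2.2.1 q hqC hqp).trans hqd.le
      have hdeep' : ‖xf i‖ + 13 / 10 * d + min γ 1 ≤ r := by linarith [min_le_right γ 1]
      exact ⟨xf i, hsub ⟨i, rfl⟩, d, η, min γ 1, A, Or.inl ⟨t, robustGood_of_deep hsub hXC hg hdeep'⟩⟩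
    · have hd50 : d ≤ 50 := (hg.2.2.2.2.1 q hqC hqp).trans hqd.le
      have hdeep' : ‖xf i‖ + 13 / 10 * d + min γ 1 ≤ r := by linarith [min_le_right γ 1]
      exact ⟨xf i, hsub ⟨i, rfl⟩, d, η, min γ 1, A, Or.inr ⟨t, robustGood_of_deep hsub hXC hg hdeep'⟩⟩
  have hcount : (Nat.card {i : Fin n // ∃ (d η γ : ℝ) (A : EuclideanSpace ℝ (Fin 3) →ₗᵢ[ℝ] EuclideanSpace ℝ (Fin 3)), (∃ t : ↥Literature.Geometry.DiscreteGeometry.fccKissingPattern → EuclideanSpace ℝ (Fin 3), 0 < d ∧ 0 < γ ∧ η < 1 / 20 ∧ (∀ u : ↥Literature.Geometry.DiscreteGeometry.fccKissingPattern, t u ∈ (Set.range xf) ∧ ‖(t u - (xf i)) - d • A (u : EuclideanSpace ℝ (Fin 3))‖ ≤ η * d) ∧ (∀ s : EuclideanSpace ℝ (Fin 3), s ∈ (Set.range xf) → s ≠ (xf i) → d ≤ dist s (xf i)) ∧ (∃ s : EuclideanSpace ℝ (Fin 3), s ∈ (Set.range xf) ∧ s ≠ (xf i) ∧ dist s (xf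 i) ≤ d) ∧ (∀ s : EuclideanSpace ℝ (Fin 3), s ∈ (Set.range xf) → s ≠ (xf i) → dist s (xf i) < 13 / 10 * d + γ → dist s (xf i) ≤ 13 / 10 * d - γ ∧ s ∈ Set.range t)) ∨ (∃ t : ↥Literature.Geometry.DiscreteGeometry.hcpKissingPattern → EuclideanSpace ℝ (Fin 3), 0 < d ∧ 0 < γ ∧ η < 1 / 20 ∧ (∀ u : ↥Literature.Geometry.DiscreteGeometry.hcpKissingPattern, t u ∈ (Set.range xf) ∧ ‖(t u - (xf i)) - d • A (u : EuclideanSpace ℝ (Fin 3))‖ ≤ η * d) ∧ (∀ s : EuclideanSpace ℝ (Fin 3), s ∈ (Set.range xf) → s ≠ (xf i) → d ≤ dist s (xf i)) ∧ (∃ s : EuclideanSpace ℝ (Fin 3), s ∈ (Set.range xf) ∧ s ≠ (xf i) ∧ dist s (xf i) ≤ d) ∧ (∀ s : EuclideanSpace ℝ (Fin 3), s ∈ (Set.range xf) → s ≠ (xf i) → dist s (xf i) < 13 / 10 * d + γ → dist s (xf i) ≤ 13 / 10 * d - γ ∧ s ∈ Set.range t))} : ℝ) ≤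
      ((Finset.univ.filter fun m : Fin n => r - Ls R < ‖xf m‖).card : ℝ) := by
    rw [Nat.card_eq_fintype_card, Fintype.card_subtype]
    exact_mod_cast Finset.card_le_card (Finset.monotone_filter_right _ fun i _ hi => hgood_shell i hi)
  -- the price inequality on the cluster (with `e⋆` under its name)
  have hprice : κ * (n : ℝ) - C * (Nat.card {i : Fin n // ∃ (d η γ : ℝ) (A : EuclideanSpace ℝ (Fin 3) →ₗᵢ[ℝ] EuclideanSpace ℝ (Fin 3)), (∃ t : ↥Literature.Geometry.DiscreteGeometry.fccKissingPattern → EuclideanSpace ℝ (Fin 3), 0 < d ∧ 0 < γ ∧ η < 1 / 20 ∧ (∀ u : ↥Literature.Geometry.DiscreteGeometry.fccKissingPattern, t u ∈ (Set.range xf) ∧ ‖(t u - (xf i)) - d • A (u : EuclideanSpace ℝ (Fin 3))‖ ≤ η * d) ∧ (∀ s : EuclideanSpace ℝ (Fin 3), s ∈ (Set.range xf) → s ≠ (xf i) → d ≤ dist s (xf i)) ∧ (∃ s : EuclideanSpace ℝ (Fin 3), s ∈ (Set.range xf) ∧ s ≠ (xf i) ∧ dist s (xf i) ≤ d) ∧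 (∀ s : EuclideanSpace ℝ (Fin 3), s ∈ (Set.range xf) → s ≠ (xf i) → dist s (xf i) < 13 / 10 * d + γ → dist s (xf i) ≤ 13 / 10 * d - γ ∧ s ∈ Set.range t)) ∨ (∃ t : ↥Literature.Geometry.DiscreteGeometry.hcpKissingPattern → EuclideanSpace ℝ (Fin 3), 0 < d ∧ 0 < γ ∧ η < 1 / 20 ∧ (∀ u : ↥Literature.Geometry.DiscreteGeometry.hcpKissingPattern, t u ∈ (Set.range xf) ∧ ‖(t u - (xf i)) - d • A (u : EuclideanSpace ℝ (Fin 3))‖ ≤ η * d) ∧ (∀ s : EuclideanSpace ℝ (Fin 3), s ∈ (Set.range xf) → s ≠ (xf i) → d ≤ dist s (xf i)) ∧ (∃ s : EuclideanSpace ℝ (Fin 3), s ∈ (Set.range xf) ∧ s ≠ (xf i) ∧ dist s (xf i) ≤ d) ∧ (∀ s : EuclideanSpace ℝ (Fin 3), s ∈ (Set.range xf) → s ≠ (xf i) → dist s (xf i) < 13 / 10 * d + γ → dist s (xf i) ≤ 13 / 10 * d - γ ∧ s ∈ Set.range t))} : ℝ) ≤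
      interactionEnergy lennardJones xf - (n : ℝ) * eStar :=
    hF n xf hinj fun a b hab => hsep (xf a) (hsub ⟨a, rfl⟩) (xf b) (hsub ⟨b, rfl⟩) fun h => hab (hinj h)
  -- abstract the real quantities
  generalize hgdef : (Nat.card {i : Fin n // ∃ (d η γ : ℝ) (A : EuclideanSpace ℝ (Fin 3) →ₗᵢ[ℝ] EuclideanSpace ℝ (Fin 3)), (∃ t : ↥Literature.Geometry.DiscreteGeometry.fccKissingPattern → EuclideanSpace ℝ (Fin 3), 0 < d ∧ 0 < γ ∧ η < 1 / 20 ∧ (∀ u : ↥Literature.Geometry.DiscreteGeometry.fccKissingPattern, t u ∈ (Set.range xf) ∧ ‖(t u - (xf i)) - d • A (u : EuclideanSpace ℝ (Fin 3))‖ ≤ η * d) ∧ (∀ s : EuclideanSpace ℝ (Fin 3), s ∈ (Set.range xf) → s ≠ (xf i) → d ≤ dist s (xf i)) ∧ (∃ s : EuclideanSpace ℝ (Fin 3), s ∈ (Set.range xf) ∧ s ≠ (xf i) ∧ dist s (xf i) ≤ d) ∧ (∀ s : EuclideanSpace ℝ (Fin 3), s ∈ (Set.range xf) → s ≠ (xf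 i) → dist s (xf i) < 13 / 10 * d + γ → dist s (xf i) ≤ 13 / 10 * d - γ ∧ s ∈ Set.range t)) ∨ (∃ t : ↥Literature.Geometry.DiscreteGeometry.hcpKissingPattern → EuclideanSpace ℝ (Fin 3), 0 < d ∧ 0 < γ ∧ η < 1 / 20 ∧ (∀ u : ↥Literature.Geometry.DiscreteGeometry.hcpKissingPattern, t u ∈ (Set.range xf) ∧ ‖(t u - (xf i)) - d • A (u : EuclideanSpace ℝ (Fin 3))‖ ≤ η * d) ∧ (∀ s : EuclideanSpace ℝ (Fin 3), s ∈ (Set.range xf) → s ≠ (xf i) → d ≤ dist s (xf i)) ∧ (∃ s : EuclideanSpace ℝ (Fin 3), s ∈ (Set.range xf) ∧ s ≠ (xf i) ∧ dist s (xf i) ≤ d) ∧ (∀ s : EuclideanSpace ℝ (Fin 3), s ∈ (Set.range xf) → s ≠ (xf i) → dist s (xf i) < 13 / 10 * d + γ → dist s (xf i) ≤ 13 / 10 * d - γ ∧ s ∈ Set.range t))} : ℝ) = g at hprice hcount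
  generalize hUdef : interactionEnergy lennardJones xf = U at hprice hex
  generalize hIdef : (∑ i, ∑' y : ↥(X \ Set.range xf), lennardJones (dist (xf i) y)) = I at hex hI hnegI
  generalize hTdef : K * (1024 / ((7 / 10 : ℝ) ^ 3 * (max (Ls R) (7 / 10)) ^ 3)) = T₁ at hI hT₁
  generalize hsdef : ((Finset.univ.filter fun m : Fin n => r - Ls R < ‖xf m‖).card : ℝ) = s at hI hcount hshell
  generalize hεdef : εs R = ε at hshell hR₂
  have hg0 : 0 ≤ g := by rw [← hgdef]; exact Nat.cast_nonneg _
  have hs0 : 0 ≤ s := by rw [← hsdef]; exact Nat.cast_nonneg _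
  -- chain: κ·n − C·g ≤ U − n·e⋆ ≤ −I ≤ |I| ≤ n·T₁ + s·T₀
  have h1 : C * g ≤ C' * s := by
    nlinarith [mul_nonneg hC'0 (sub_nonneg.2 hcount), mul_nonneg (sub_nonneg.2 hCC') hg0]
  have h2 : (n : ℝ) * T₁ ≤ n * (κ / 4) := mul_le_mul_of_nonneg_left hT₁ hnr.le
  have hTC : 0 ≤ T₀ + C' := add_nonneg hT₀ hC'0
  have h3 : s * (T₀ + C') ≤ ε * n * (T₀ + C') := mul_le_mul_of_nonneg_right hshell hTC
  have hεb : ε * (T₀ + C') ≤ κ / 4 := by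
    by_cases hε0 : 0 ≤ ε
    · have h4 : ε * (T₀ + C') ≤ ε * (T₀ + C' + 1) := mul_le_mul_of_nonneg_left (by linarith) hε0
      have h5 : ε * (T₀ + C' + 1) ≤ κ / (4 * (T₀ + C' + 1)) * (T₀ + C' + 1) :=
        mul_le_mul_of_nonneg_right hR₂.le (by positivity)
      have h6 : κ / (4 * (T₀ + C' + 1)) * (T₀ + C' + 1) = κ / 4 := by
        field_simp
      linarith
    · rw [not_le] at hε0
      have : ε * (T₀ + C') ≤ 0 := mul_nonpos_of_nonpos_of_nonneg hε0.le hTC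
      linarith
  have h4 : ε * n * (T₀ + C') ≤ n * (κ / 4) := by
    have := mul_le_mul_of_nonneg_left hεb hnr.le
    linarith
  have key : κ * n ≤ n * (κ / 4) + n * (κ / 4) := by linarith
  have : κ * n ≤ 0 := by linarith
  exact absurd this (not_le.2 (mul_pos hκ hnr))

end Summit.AtomisticToContinuum.Crystallization.Theorems.FrustratedLawDichotomyLocalCloseOrderFinite

end
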